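import Summits.NavierStokesRegularity.NavierStokesRegularity.Theorems.CoriolisHeadCounterRotatingLiouvilleGradientEstimate
import Literature.Analysis.FluidPDE.TsaiPressureBootstrap

/-!
# Route CoriolisHead · crux `CounterRotatingLiouville` (stmt-NavierStokesRegularity-22677) —
# towards stub 2 `stub_rssHeadGrowth`: Lemma 3.1, the rotated body force and the Stokes step

Support file of the line `tsai-rotating-head-chain` (theorems only; `--supports … --as helper`).
Port of parts of the tree's `FluidPDE/TsaiBootstrapTools` and `FluidPDE/TsaiPressureBootstrap`
(Tsai 1998, §3.2) to the ROTATED profile system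
`−νΔU + aU + a(y·∇)U + (BU − (By·∇)U) + (U·∇)U + ∇P = 0`, `div U = 0`, `B` skew:
Lemma 3.1 `‖DU‖_{L²(B(x₀,324R))} ≤ K(1 + |x₀|)` (`exists_eLpNorm_fderiv_two_le_of_rotated`); the
body force `F = aU + a(y·∇)U + (BU − (By·∇)U) + (U·∇)U = νΔU − ∇P` and, for BOUNDED `U`, its bound
`‖F‖_{L^p(B(x₀,R))} ≤ (|a| + ‖B‖)‖U‖_p + ((|a| + ‖B‖)(|x₀| + R) + M)‖DU‖_p`
(`eLpNorm_bodyForce_le_of_rotated`, `exists_poly_bound_bodyForce_of_rotated`); the interior Stokes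
estimate (3.2) for `(U, P − c)` (`stokes_estimate_of_rotated`, `exists_poly_bound_stokes_of_rotated`;
the named fact `stokes_interior_Lr_estimate` is discharged in the tree).  NS regularity NOT proved here.
-/

noncomputable section

-- the summit and its single sub-problem share the name (CONVENTIONS §1), as in every Theorems file
set_option linter.dupNamespace false

open MeasureTheory Set Function Filter Topology InnerProductSpace Metric
open scoped RealInnerProductSpace Laplacian ContDiff BigOperators ENNReal NNReal
open Literature.Analysis.FluidPDE

namespace Summit.NavierStokesRegularity.NavierStokesRegularity.Theorems.CoriolisHead

section StokesRound

-- nested operator types `ℝ³ →L[ℝ] ℝ³ →L[ℝ] ℝ³`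
set_option maxSynthPendingDepth 3

variable {ν a : ℝ} {B : EuclideanSpace ℝ (Fin 3) →L[ℝ] EuclideanSpace ℝ (Fin 3)}
  {U : (EuclideanSpace ℝ (Fin 3)) → (EuclideanSpace ℝ (Fin 3))} {P : (EuclideanSpace ℝ (Fin 3)) → ℝ}

/-- **Lemma 3.1 for rotated profiles (energy)** (port of
`IsLerayProfile.exists_integral_frobeniusNormSq_le`): for `U ∈ C^∞ ∩ L^q`, `3 ≤ q ≤ ∞`, `ν > 0`,
`a ≥ 0`, `B` skew, and a local pressure control `‖P − c_{x₀}‖_{L^{3/2}(B(x₀,1000R))} ≤ K_P(1 + |x₀|)`,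
`∫_{B(x₀,324R)} |DU|² ≤ K (1 + |x₀|)` for all centres. -/
theorem exists_integral_frobeniusNormSq_le_of_rotated (hU : ContDiff ℝ ∞ U) (hP2 : ContDiff ℝ 2 P)
    (hB : ∀ x, ⟪B x, x⟫ = 0) (hdiv : VectorCalculus.IsDivFree U)
    (heq : ∀ y, -(ν • (Δ U) y) + a • U y + a • fderiv ℝ U y y + (B (U y) - fderiv ℝ U y (B y)) +
      convect U U y + gradient P y = 0)
    (hν : 0 < ν) (ha : 0 ≤ a) {q : ℝ≥0∞} (hq : 3 ≤ q) (hUq : MemLp U q volume)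
    {R : ℝ} (hR : 0 < R) {c : (EuclideanSpace ℝ (Fin 3)) → ℝ} {K_P : ℝ} (hK_P : 0 ≤ K_P)
    (hPc : ∀ x₀ : (EuclideanSpace ℝ (Fin 3)), eLpNorm (fun x => P x - c x₀) (ENNReal.ofReal (3 / 2))
      (volume.restrict (ball x₀ (1000 * R))) ≤ ENNReal.ofReal (K_P * (1 + ‖x₀‖))) :
    ∃ K : ℝ, 0 ≤ K ∧ ∀ x₀ : (EuclideanSpace ℝ (Fin 3)), ∫ x in ball x₀ (324 * R), frobeniusNormSq (fderiv ℝ U x) ≤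
      K * (1 + ‖x₀‖) := by
  obtain ⟨C₁, C₂, hC₁, hC₂, h31⟩ := exists_gradient_estimate_consts_of_rotated
  have hUc : Continuous U := hU.continuous
  have hU1 : ContDiff ℝ 1 U := hU.of_le (by norm_cast)
  have hP1 : ContDiff ℝ 1 P := hP2.of_le one_le_two
  have hBn : 0 ≤ ‖B‖ := norm_nonneg _
  -- uniform data
  obtain ⟨MU, hMU0, hMUq⟩ : ∃ MU : ℝ, 0 ≤ MU ∧ eLpNorm U q volume ≤ ENNReal.ofReal MU :=
    ⟨(eLpNorm U q volume).toReal, ENNReal.toReal_nonneg, (ENNReal.ofReal_toReal hUq.eLpNorm_ne_top).ge⟩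
  set R' : ℝ := 324 * R with hR'
  have hR'0 : 0 < R' := by positivity
  set A₂ : ℝ := ((volume (closedBall (0 : (EuclideanSpace ℝ (Fin 3))) (2 * R'))) ^ (1 - 1 / (q / 2).toReal)).toReal * MU ^ 2 with hA₂
  set A₃ : ℝ := ((volume (closedBall (0 : (EuclideanSpace ℝ (Fin 3))) (2 * R'))) ^ (1 - 1 / (q / 3).toReal)).toReal * MU ^ 3 with hA₃
  have hA₂0 : 0 ≤ A₂ := mul_nonneg ENNReal.toReal_nonneg (pow_nonneg hMU0 2)
  have hA₃0 : 0 ≤ A₃ := mul_nonneg ENNReal.toReal_nonneg (pow_nonneg hMU0 3)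
  obtain ⟨CU3, hCU30, hCU3⟩ := exists_eLpNorm_restrict_ball_le_of_memLp hUc hUq (s := 3) (by norm_num) hq (1000 * R)
  have hJ₂ : ∀ x₀, ∫ x in closedBall x₀ (2 * R'), ‖U x‖ ^ 2 ≤ A₂ := fun x₀ =>
    setIntegral_norm_sq_le_of_eLpNorm_le hUc (le_trans (by norm_num) hq) hMU0 hMUq x₀ (2 * R')
  have hJ₃ : ∀ x₀, ∫ x in closedBall x₀ (2 * R'), ‖U x‖ ^ 3 ≤ A₃ := fun x₀ =>
    setIntegral_norm_pow_three_le_of_eLpNorm_le hUc hq hMU0 hMUq x₀ (2 * R')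
  have hJP : ∀ x₀, ∫ x in closedBall x₀ (2 * R'), |P x - c x₀| * ‖U x‖ ≤ K_P * (1 + ‖x₀‖) * CU3 := by
    intro x₀
    have h2R' : 2 * R' < 1000 * R := by rw [hR']; linarith
    have h := integral_closedBall_mul_le_eLpNorm_mul (hP1.continuous.sub continuous_const) hUc x₀ h2R'
      (f := fun x => P x - c x₀)
    refine h.trans ?_
    have e1 : (eLpNorm (fun x => P x - c x₀) (ENNReal.ofReal (3 / 2)) (volume.restrict (ball x₀ (1000 * R)))).toReal
        ≤ K_P * (1 + ‖x₀‖) :=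
      ENNReal.toReal_le_of_le_ofReal (by positivity) (hPc x₀)
    have e2 : (eLpNorm U 3 (volume.restrict (ball x₀ (1000 * R)))).toReal ≤ CU3 :=
      ENNReal.toReal_le_of_le_ofReal hCU30 (hCU3 x₀)
    exact mul_le_mul e1 e2 ENNReal.toReal_nonneg (by positivity)
  -- the constant
  set α : ℝ := ν * C₂ / (2 * R' ^ 2) + a / 2 with hα
  set β : ℝ := (a + ‖B‖) * C₁ / (2 * R') with hβ
  have hα0 : 0 ≤ α := by positivity
  have hβ0 : 0 ≤ β := by positivity
  set K₀ : ℝ := ((α + β * (1 + 2 * R')) * A₂ + C₁ / (2 * R') * A₃ + C₁ / R' * (K_P * CU3)) / ν with hK₀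
  have hK₀0 : 0 ≤ K₀ := by positivity
  refine ⟨K₀, hK₀0, fun x₀ => ?_⟩
  have ht : 0 ≤ ‖x₀‖ := norm_nonneg _
  -- (3.1)
  have h := h31 hU hP2 hB hdiv heq hν.le ha hR'0 x₀ (c x₀)
  have hJ₂x0 : 0 ≤ ∫ x in closedBall x₀ (2 * R'), ‖U x‖ ^ 2 := integral_nonneg fun x => by positivity
  have hcoef_eq : ν * C₂ / (2 * R' ^ 2) + a / 2 + (a + ‖B‖) * C₁ * (‖x₀‖ + 2 * R') / (2 * R') =
      α + β * (‖x₀‖ + 2 * R') := by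
    rw [hα, hβ]; ring
  have hcoef : ν * C₂ / (2 * R' ^ 2) + a / 2 + (a + ‖B‖) * C₁ * (‖x₀‖ + 2 * R') / (2 * R') ≤
      (α + β * (1 + 2 * R')) * (1 + ‖x₀‖) := by
    rw [hcoef_eq]
    have h1 : ‖x₀‖ + 2 * R' ≤ (1 + 2 * R') * (1 + ‖x₀‖) := by nlinarith
    nlinarith [mul_le_mul_of_nonneg_left h1 hβ0]
  have m1 : (ν * C₂ / (2 * R' ^ 2) + a / 2 + (a + ‖B‖) * C₁ * (‖x₀‖ + 2 * R') / (2 * R')) *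
      (∫ x in closedBall x₀ (2 * R'), ‖U x‖ ^ 2) ≤ (α + β * (1 + 2 * R')) * (1 + ‖x₀‖) * A₂ :=
    mul_le_mul hcoef (hJ₂ x₀) hJ₂x0 (by positivity)
  have m2 : C₁ / (2 * R') * (∫ x in closedBall x₀ (2 * R'), ‖U x‖ ^ 3) ≤ C₁ / (2 * R') * A₃ :=
    mul_le_mul_of_nonneg_left (hJ₃ x₀) (by positivity)
  have m3 : C₁ / R' * (∫ x in closedBall x₀ (2 * R'), |P x - c x₀| * ‖U x‖) ≤
      C₁ / R' * (K_P * (1 + ‖x₀‖) * CU3) :=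
    mul_le_mul_of_nonneg_left (hJP x₀) (by positivity)
  show ∫ x in ball x₀ R', frobeniusNormSq (fderiv ℝ U x) ≤ K₀ * (1 + ‖x₀‖)
  · have hK₀ν : K₀ * ν = (α + β * (1 + 2 * R')) * A₂ + C₁ / (2 * R') * A₃ + C₁ / R' * (K_P * CU3) := by
      rw [hK₀]; field_simp
    have e3 : C₁ / (2 * R') * A₃ ≤ C₁ / (2 * R') * A₃ * (1 + ‖x₀‖) := by
      have : 0 ≤ C₁ / (2 * R') * A₃ := by positivity
      nlinarith
    have hν' : ν * ∫ x in ball x₀ R', frobeniusNormSq (fderiv ℝ U x) ≤ ν * (K₀ * (1 + ‖x₀‖)) := by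
      have : ν * (K₀ * (1 + ‖x₀‖)) = (K₀ * ν) * (1 + ‖x₀‖) := by ring
      rw [this, hK₀ν]
      linarith [m1, m2, m3, h, e3]
    exact le_of_mul_le_mul_left hν' hν

/-- **Lemma 3.1 for rotated profiles, quantitative form**:
`‖DU‖_{L²(B(x₀,324R))} ≤ K (1 + |x₀|)` for all centres (port of
`IsLerayProfile.exists_eLpNorm_fderiv_two_le`). -/
theorem exists_eLpNorm_fderiv_two_le_of_rotated (hU : ContDiff ℝ ∞ U) (hP2 : ContDiff ℝ 2 P)
    (hB : ∀ x, ⟪B x, x⟫ = 0) (hdiv : VectorCalculus.IsDivFree U)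
    (heq : ∀ y, -(ν • (Δ U) y) + a • U y + a • fderiv ℝ U y y + (B (U y) - fderiv ℝ U y (B y)) +
      convect U U y + gradient P y = 0)
    (hν : 0 < ν) (ha : 0 ≤ a) {q : ℝ≥0∞} (hq : 3 ≤ q) (hUq : MemLp U q volume)
    {R : ℝ} (hR : 0 < R) {c : (EuclideanSpace ℝ (Fin 3)) → ℝ} {K_P : ℝ} (hK_P : 0 ≤ K_P)
    (hPc : ∀ x₀ : (EuclideanSpace ℝ (Fin 3)), eLpNorm (fun x => P x - c x₀) (ENNReal.ofReal (3 / 2))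
      (volume.restrict (ball x₀ (1000 * R))) ≤ ENNReal.ofReal (K_P * (1 + ‖x₀‖))) :
    ∃ K : ℝ, 0 ≤ K ∧ ∀ x₀ : (EuclideanSpace ℝ (Fin 3)), eLpNorm (fun x => fderiv ℝ U x) 2
      (volume.restrict (ball x₀ (324 * R))) ≤ ENNReal.ofReal (K * (1 + ‖x₀‖)) := by
  obtain ⟨K₀, hK₀0, hfrob⟩ := exists_integral_frobeniusNormSq_le_of_rotated hU hP2 hB hdiv heq hν ha hq hUq hR
    hK_P hPc
  have hU1 : ContDiff ℝ 1 U := hU.of_le (by norm_cast)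
  refine ⟨1 + K₀, by positivity, fun x₀ => ?_⟩
  have ht : 0 ≤ ‖x₀‖ := norm_nonneg _
  have hmem : MemLp (fun x => fderiv ℝ U x) 2 (volume.restrict (ball x₀ (324 * R))) :=
    memLp_restrict_ball_of_continuous (hU1.continuous_fderiv one_ne_zero) x₀ (324 * R) 2
  have hgi : Integrable (fun x => frobeniusNormSq (fderiv ℝ U x)) (volume.restrict (ball x₀ (324 * R))) :=
    ((continuous_frobeniusNormSq_fderiv hU1 one_ne_zero).continuousOn.integrableOn_compact
      (isCompact_closedBall x₀ (324 * R))).mono_set ball_subset_closedBall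
  have hL2 := eLpNorm_two_le_sqrt_of_sq_le hmem (fun x => sq_opNorm_le_frobeniusNormSq (fderiv ℝ U x))
    hgi (hfrob x₀)
  refine hL2.trans (ENNReal.ofReal_le_ofReal ?_)
  have hy : 0 ≤ K₀ * (1 + ‖x₀‖) := by positivity
  calc Real.sqrt (K₀ * (1 + ‖x₀‖)) ≤ 1 + K₀ * (1 + ‖x₀‖) := by
        nlinarith [Real.sq_sqrt hy, Real.sqrt_nonneg (K₀ * (1 + ‖x₀‖))]
    _ ≤ (1 + K₀) * (1 + ‖x₀‖) := by nlinarith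

/-! ### The body force of the rotated system and its `L^p` bound for bounded `U` -/

/-- **The rotated system as a Stokes system**:
`νΔU − ∇(P − c) = F := aU + a(y·∇)U + (BU − (By·∇)U) + (U·∇)U`. -/
theorem body_force_eq_sub_const_of_rotated
    (heq : ∀ y, -(ν • (Δ U) y) + a • U y + a • fderiv ℝ U y y + (B (U y) - fderiv ℝ U y (B y)) +
      convect U U y + gradient P y = 0) (c : ℝ) (x : (EuclideanSpace ℝ (Fin 3))) :
    ν • (Δ U) x - gradient (fun y => P y - c) x =
      a • U x + a • fderiv ℝ U x x + (B (U x) - fderiv ℝ U x (B x)) + convect U U x := by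
  have hg : gradient (fun y => P y - c) x = gradient P x := by simp only [gradient, fderiv_sub_const]
  have hx := heq x
  rw [hg, ← sub_eq_zero, ← neg_eq_zero, ← hx]
  abel

/-- **`L^p` bound for the rotated body force on a ball, bounded velocity**: for `U ∈ C¹` with
`‖U‖ ≤ M`, `1 ≤ p`,
`‖aU + a(y·∇)U + (BU − (By·∇)U) + (U·∇)U‖_{L^p(B(x₀,R))} ≤ (|a| + ‖B‖) ‖U‖_p + ((|a| + ‖B‖)(|x₀| + R) + M) ‖DU‖_p`
(pointwise `‖F(x)‖ ≤ (|a| + ‖B‖)‖U(x)‖ + ((|a| + ‖B‖)(|x₀| + R) + M)‖DU(x)‖` on the ball). -/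
theorem eLpNorm_bodyForce_le_of_rotated (hU : ContDiff ℝ 1 U) (a : ℝ)
    (B : EuclideanSpace ℝ (Fin 3) →L[ℝ] EuclideanSpace ℝ (Fin 3)) {M : ℝ} (hM : ∀ y, ‖U y‖ ≤ M)
    (x₀ : (EuclideanSpace ℝ (Fin 3))) {R : ℝ} (hR : 0 ≤ R) {p : ℝ≥0∞} (hp : 1 ≤ p) :
    eLpNorm (fun x => a • U x + a • fderiv ℝ U x x + (B (U x) - fderiv ℝ U x (B x)) + convect U U x) p
        (volume.restrict (ball x₀ R)) ≤
      ENNReal.ofReal (|a| + ‖B‖) * eLpNorm U p (volume.restrict (ball x₀ R)) +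
        ENNReal.ofReal ((|a| + ‖B‖) * (‖x₀‖ + R) + M) *
          eLpNorm (fun x => fderiv ℝ U x) p (volume.restrict (ball x₀ R)) := by
  set μ := (volume : Measure (EuclideanSpace ℝ (Fin 3))).restrict (ball x₀ R) with hμ
  have hUc : Continuous U := hU.continuous
  have hDUc : Continuous fun x => fderiv ℝ U x := hU.continuous_fderiv one_ne_zero
  have hM0 : 0 ≤ M := (norm_nonneg _).trans (hM 0)
  have hm1 : AEStronglyMeasurable (fun x => a • U x + B (U x)) μ :=
    ((hUc.const_smul a).add (B.continuous.comp hUc)).aestronglyMeasurable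
  have hm2 : AEStronglyMeasurable (fun x => a • fderiv ℝ U x x - fderiv ℝ U x (B x) + convect U U x) μ :=
    ((((hDUc.clm_apply continuous_id).const_smul a).sub (hDUc.clm_apply B.continuous)).add
      (hDUc.clm_apply hUc)).aestronglyMeasurable
  -- regroup: `F = (aU + BU) + (a DU x − DU (Bx) + DU U)`
  have hsplit : (fun x => a • U x + a • fderiv ℝ U x x + (B (U x) - fderiv ℝ U x (B x)) + convect U U x) =
      fun x => (a • U x + B (U x)) + (a • fderiv ℝ U x x - fderiv ℝ U x (B x) + convect U U x) := by
    funext x; abel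
  rw [hsplit]
  -- term 1: `‖aU + BU‖ ≤ (|a| + ‖B‖)‖U‖`
  have t1 : eLpNorm (fun x => a • U x + B (U x)) p μ ≤ ENNReal.ofReal (|a| + ‖B‖) * eLpNorm U p μ := by
    have hbd : ∀ᵐ x ∂μ, ‖a • U x + B (U x)‖ ≤ (|a| + ‖B‖) * ‖U x‖ :=
      Eventually.of_forall fun x => by
        calc ‖a • U x + B (U x)‖ ≤ ‖a • U x‖ + ‖B (U x)‖ := norm_add_le _ _
          _ ≤ |a| * ‖U x‖ + ‖B‖ * ‖U x‖ := by
              rw [norm_smul, Real.norm_eq_abs]; gcongr; exact B.le_opNorm _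
          _ = (|a| + ‖B‖) * ‖U x‖ := by ring
    calc eLpNorm (fun x => a • U x + B (U x)) p μ
        ≤ eLpNorm (fun x => (|a| + ‖B‖) * ‖U x‖) p μ := eLpNorm_mono_ae_real hbd
      _ = ENNReal.ofReal (|a| + ‖B‖) * eLpNorm U p μ := by
          have : (fun x => (|a| + ‖B‖) * ‖U x‖) = (|a| + ‖B‖) • fun x => ‖U x‖ := rfl
          rw [this, eLpNorm_const_smul, eLpNorm_norm, Real.enorm_eq_ofReal (by positivity)]
  -- term 2: `‖a DU x − DU(Bx) + DU U‖ ≤ ((|a| + ‖B‖)(|x₀| + R) + M)‖DU‖` on the ball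
  have t2 : eLpNorm (fun x => a • fderiv ℝ U x x - fderiv ℝ U x (B x) + convect U U x) p μ ≤
      ENNReal.ofReal ((|a| + ‖B‖) * (‖x₀‖ + R) + M) * eLpNorm (fun x => fderiv ℝ U x) p μ := by
    have hbd : ∀ᵐ x ∂μ, ‖a • fderiv ℝ U x x - fderiv ℝ U x (B x) + convect U U x‖ ≤
        ((|a| + ‖B‖) * (‖x₀‖ + R) + M) * ‖fderiv ℝ U x‖ := by
      rw [hμ, ae_restrict_iff' measurableSet_ball]
      refine Eventually.of_forall fun x hx => ?_
      rw [mem_ball, dist_eq_norm] at hx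
      have hxn : ‖x‖ ≤ ‖x₀‖ + R := by
        calc ‖x‖ = ‖(x - x₀) + x₀‖ := by rw [sub_add_cancel]
          _ ≤ ‖x - x₀‖ + ‖x₀‖ := norm_add_le _ _
          _ ≤ R + ‖x₀‖ := by gcongr
          _ = ‖x₀‖ + R := add_comm _ _
      have e1 : ‖a • fderiv ℝ U x x‖ ≤ |a| * (‖x₀‖ + R) * ‖fderiv ℝ U x‖ := by
        rw [norm_smul, Real.norm_eq_abs, mul_assoc]
        gcongr
        calc ‖fderiv ℝ U x x‖ ≤ ‖fderiv ℝ U x‖ * ‖x‖ := ContinuousLinearMap.le_opNorm _ _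
          _ ≤ ‖fderiv ℝ U x‖ * (‖x₀‖ + R) := by gcongr
          _ = (‖x₀‖ + R) * ‖fderiv ℝ U x‖ := mul_comm _ _
      have e2 : ‖fderiv ℝ U x (B x)‖ ≤ ‖B‖ * (‖x₀‖ + R) * ‖fderiv ℝ U x‖ := by
        calc ‖fderiv ℝ U x (B x)‖ ≤ ‖fderiv ℝ U x‖ * ‖B x‖ := ContinuousLinearMap.le_opNorm _ _
          _ ≤ ‖fderiv ℝ U x‖ * (‖B‖ * ‖x‖) := by gcongr; exact B.le_opNorm _
          _ ≤ ‖fderiv ℝ U x‖ * (‖B‖ * (‖x₀‖ + R)) := by gcongr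
          _ = ‖B‖ * (‖x₀‖ + R) * ‖fderiv ℝ U x‖ := by ring
      have e3 : ‖convect U U x‖ ≤ M * ‖fderiv ℝ U x‖ := by
        rw [convect_apply]
        calc ‖fderiv ℝ U x (U x)‖ ≤ ‖fderiv ℝ U x‖ * ‖U x‖ := ContinuousLinearMap.le_opNorm _ _
          _ ≤ ‖fderiv ℝ U x‖ * M := by gcongr; exact hM x
          _ = M * ‖fderiv ℝ U x‖ := mul_comm _ _
      calc ‖a • fderiv ℝ U x x - fderiv ℝ U x (B x) + convect U U x‖
          ≤ ‖a • fderiv ℝ U x x - fderiv ℝ U x (B x)‖ + ‖convect U U x‖ := norm_add_le _ _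
        _ ≤ ‖a • fderiv ℝ U x x‖ + ‖fderiv ℝ U x (B x)‖ + ‖convect U U x‖ := by
            gcongr; exact norm_sub_le _ _
        _ ≤ |a| * (‖x₀‖ + R) * ‖fderiv ℝ U x‖ + ‖B‖ * (‖x₀‖ + R) * ‖fderiv ℝ U x‖ +
              M * ‖fderiv ℝ U x‖ := add_le_add (add_le_add e1 e2) e3
        _ = ((|a| + ‖B‖) * (‖x₀‖ + R) + M) * ‖fderiv ℝ U x‖ := by ring
    calc eLpNorm (fun x => a • fderiv ℝ U x x - fderiv ℝ U x (B x) + convect U U x) p μ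
        ≤ eLpNorm (fun x => ((|a| + ‖B‖) * (‖x₀‖ + R) + M) * ‖fderiv ℝ U x‖) p μ :=
          eLpNorm_mono_ae_real hbd
      _ = ENNReal.ofReal ((|a| + ‖B‖) * (‖x₀‖ + R) + M) * eLpNorm (fun x => fderiv ℝ U x) p μ := by
          have : (fun x => ((|a| + ‖B‖) * (‖x₀‖ + R) + M) * ‖fderiv ℝ U x‖) =
              ((|a| + ‖B‖) * (‖x₀‖ + R) + M) • fun x => ‖fderiv ℝ U x‖ := rfl
          rw [this, eLpNorm_const_smul, eLpNorm_norm, Real.enorm_eq_ofReal (by positivity)]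
  calc eLpNorm (fun x => (a • U x + B (U x)) + (a • fderiv ℝ U x x - fderiv ℝ U x (B x) + convect U U x)) p μ
      ≤ eLpNorm (fun x => a • U x + B (U x)) p μ +
          eLpNorm (fun x => a • fderiv ℝ U x x - fderiv ℝ U x (B x) + convect U U x) p μ :=
        eLpNorm_add_le hm1 hm2 hp
    _ ≤ _ := add_le_add t1 t2

/-- **Polynomial bound for the rotated body force, bounded velocity**: polynomial bounds for
`U`, `DU` in `L^p(B(x₀,R))` (degrees `m₁`, `m₂`) give one of degree `max m₁ (m₂ + 1)` for `F`. -/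
theorem exists_poly_bound_bodyForce_of_rotated (hU : ContDiff ℝ 1 U) (a : ℝ)
    (B : EuclideanSpace ℝ (Fin 3) →L[ℝ] EuclideanSpace ℝ (Fin 3)) {M : ℝ} (hM : ∀ y, ‖U y‖ ≤ M)
    {R : ℝ} (hR : 0 < R) {p : ℝ≥0∞} (hp : 1 ≤ p) {K₁ K₂ : ℝ} (hK₁ : 0 ≤ K₁) (hK₂ : 0 ≤ K₂)
    {m₁ m₂ : ℕ}
    (h₁ : ∀ x₀ : (EuclideanSpace ℝ (Fin 3)), eLpNorm U p (volume.restrict (ball x₀ R)) ≤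
      ENNReal.ofReal (K₁ * (1 + ‖x₀‖) ^ m₁))
    (h₂ : ∀ x₀ : (EuclideanSpace ℝ (Fin 3)), eLpNorm (fun x => fderiv ℝ U x) p (volume.restrict (ball x₀ R)) ≤
      ENNReal.ofReal (K₂ * (1 + ‖x₀‖) ^ m₂)) :
    ∃ K : ℝ, 0 ≤ K ∧ ∀ x₀ : (EuclideanSpace ℝ (Fin 3)),
      eLpNorm (fun x => a • U x + a • fderiv ℝ U x x + (B (U x) - fderiv ℝ U x (B x)) + convect U U x) p
          (volume.restrict (ball x₀ R)) ≤
        ENNReal.ofReal (K * (1 + ‖x₀‖) ^ (max m₁ (m₂ + 1))) := by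
  have hM0 : 0 ≤ M := (norm_nonneg _).trans (hM 0)
  set Mx : ℕ := max m₁ (m₂ + 1) with hMx
  refine ⟨(|a| + ‖B‖) * K₁ + ((|a| + ‖B‖) * max 1 R + M) * K₂, by positivity, fun x₀ => ?_⟩
  have ht : 0 ≤ ‖x₀‖ := norm_nonneg _
  refine (eLpNorm_bodyForce_le_of_rotated hU a B hM x₀ hR.le hp).trans ?_
  have hmR : ‖x₀‖ + R ≤ max 1 R * (1 + ‖x₀‖) := add_le_max_one_mul_one_add ht R
  have t1 : ENNReal.ofReal (|a| + ‖B‖) * eLpNorm U p (volume.restrict (ball x₀ R)) ≤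
      ENNReal.ofReal (((|a| + ‖B‖) * K₁) * (1 + ‖x₀‖) ^ Mx) := by
    calc ENNReal.ofReal (|a| + ‖B‖) * eLpNorm U p (volume.restrict (ball x₀ R))
        ≤ ENNReal.ofReal (|a| + ‖B‖) * ENNReal.ofReal (K₁ * (1 + ‖x₀‖) ^ m₁) := by gcongr; exact h₁ x₀
      _ = ENNReal.ofReal (((|a| + ‖B‖) * K₁) * (1 + ‖x₀‖) ^ m₁) := by
          rw [← ENNReal.ofReal_mul (by positivity), mul_assoc]
      _ ≤ ENNReal.ofReal (((|a| + ‖B‖) * K₁) * (1 + ‖x₀‖) ^ Mx) :=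
          ofReal_poly_le_of_le (by positivity) ht (by rw [hMx]; omega)
  have t2 : ENNReal.ofReal ((|a| + ‖B‖) * (‖x₀‖ + R) + M) *
      eLpNorm (fun x => fderiv ℝ U x) p (volume.restrict (ball x₀ R)) ≤
      ENNReal.ofReal ((((|a| + ‖B‖) * max 1 R + M) * K₂) * (1 + ‖x₀‖) ^ Mx) := by
    have hc : (|a| + ‖B‖) * (‖x₀‖ + R) + M ≤ ((|a| + ‖B‖) * max 1 R + M) * (1 + ‖x₀‖) := by
      have h1 : M ≤ M * (1 + ‖x₀‖) := le_mul_of_one_le_right hM0 (by linarith)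
      nlinarith [mul_le_mul_of_nonneg_left hmR (by positivity : 0 ≤ |a| + ‖B‖)]
    calc ENNReal.ofReal ((|a| + ‖B‖) * (‖x₀‖ + R) + M) *
          eLpNorm (fun x => fderiv ℝ U x) p (volume.restrict (ball x₀ R))
        ≤ ENNReal.ofReal (((|a| + ‖B‖) * max 1 R + M) * (1 + ‖x₀‖)) *
            ENNReal.ofReal (K₂ * (1 + ‖x₀‖) ^ m₂) := by
          gcongr
          exact h₂ x₀
      _ = ENNReal.ofReal ((((|a| + ‖B‖) * max 1 R + M) * K₂) * (1 + ‖x₀‖) ^ (m₂ + 1)) := by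
          rw [← ENNReal.ofReal_mul (by positivity), pow_succ]
          ring_nf
      _ ≤ ENNReal.ofReal ((((|a| + ‖B‖) * max 1 R + M) * K₂) * (1 + ‖x₀‖) ^ Mx) :=
          ofReal_poly_le_of_le (by positivity) ht (by rw [hMx]; omega)
  calc ENNReal.ofReal (|a| + ‖B‖) * eLpNorm U p (volume.restrict (ball x₀ R)) +
        ENNReal.ofReal ((|a| + ‖B‖) * (‖x₀‖ + R) + M) *
          eLpNorm (fun x => fderiv ℝ U x) p (volume.restrict (ball x₀ R))
      ≤ ENNReal.ofReal (((|a| + ‖B‖) * K₁) * (1 + ‖x₀‖) ^ Mx) +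
          ENNReal.ofReal ((((|a| + ‖B‖) * max 1 R + M) * K₂) * (1 + ‖x₀‖) ^ Mx) := add_le_add t1 t2
    _ = ENNReal.ofReal (((|a| + ‖B‖) * K₁ + ((|a| + ‖B‖) * max 1 R + M) * K₂) * (1 + ‖x₀‖) ^ Mx) := by
        rw [← ENNReal.ofReal_add (by positivity) (by positivity)]
        ring_nf

/-- **The interior Stokes estimate for a rotated profile** (Tsai's (3.2) applied to
`(v, π) = (U, P − c)`, `f = F`; port of `IsLerayProfile.stokes_estimate`). -/
theorem stokes_estimate_of_rotated (hSt : stokes_interior_Lr_estimate) (hU : ContDiff ℝ ∞ U)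
    (hP2 : ContDiff ℝ 2 P) (hdiv : VectorCalculus.IsDivFree U)
    (heq : ∀ y, -(ν • (Δ U) y) + a • U y + a • fderiv ℝ U y y + (B (U y) - fderiv ℝ U y (B y)) +
      convect U U y + gradient P y = 0)
    (hν : 0 < ν) {r : ℝ≥0∞} (hr : 1 < r) (hr' : r < ⊤) {R : ℝ} (hR : 0 < R) :
    ∃ C : ℝ≥0, ∀ (x₀ : (EuclideanSpace ℝ (Fin 3))) (c : ℝ),
      eLpNorm (fun x => iteratedFDeriv ℝ 2 U x) r (volume.restrict (ball x₀ R)) +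
          eLpNorm (fun x => fderiv ℝ P x) r (volume.restrict (ball x₀ R)) ≤
        C * (eLpNorm (fun x => a • U x + a • fderiv ℝ U x x + (B (U x) - fderiv ℝ U x (B x)) +
                convect U U x) r (volume.restrict (ball x₀ (2 * R))) +
            eLpNorm U r (volume.restrict (ball x₀ (2 * R))) +
            eLpNorm (fun x => fderiv ℝ U x) r (volume.restrict (ball x₀ (2 * R))) +
            eLpNorm (fun x => P x - c) r (volume.restrict (ball x₀ (2 * R)))) := by
  obtain ⟨C, hC⟩ := stokes_interior_Lr_estimate_ball hSt hν hr hr' hR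
  refine ⟨C, fun x₀ c => ?_⟩
  have hU2 : ContDiff ℝ 2 U := hU.of_le (by norm_cast)
  have hP1 : ContDiff ℝ 1 P := hP2.of_le one_le_two
  have hπ1 : ContDiff ℝ 1 fun x => P x - c := hP1.sub contDiff_const
  have hdiv' : ∀ x ∈ ball x₀ (2 * R), VectorCalculus.divergence U x = 0 := fun x _ => hdiv x
  have h := hC x₀ U (fun x => P x - c) hU2 hπ1 hdiv'
  have hF : (fun x => ν • (Δ U) x - gradient (fun y => P y - c) x) =
      fun x => a • U x + a • fderiv ℝ U x x + (B (U x) - fderiv ℝ U x (B x)) + convect U U x :=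
    funext (body_force_eq_sub_const_of_rotated heq c)
  have hDπ : (fun x => fderiv ℝ (fun y => P y - c) x) = fun x => fderiv ℝ P x :=
    funext fun x => fderiv_sub_const c
  rw [hF, hDπ] at h
  exact h

/-- **Stokes step for rotated profiles** (port of `IsLerayProfile.exists_poly_bound_stokes`):
polynomial bounds of a common degree for `F`, `U`, `DU`, `P − c_{x₀}` in `L^r(B(x₀, 2S))` give
polynomial bounds of the same degree for `D²U`, `∇P` in `L^r(B(x₀, S))`. -/
theorem exists_poly_bound_stokes_of_rotated (hSt : stokes_interior_Lr_estimate)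
    (hU : ContDiff ℝ ∞ U) (hP2 : ContDiff ℝ 2 P) (hdiv : VectorCalculus.IsDivFree U)
    (heq : ∀ y, -(ν • (Δ U) y) + a • U y + a • fderiv ℝ U y y + (B (U y) - fderiv ℝ U y (B y)) +
      convect U U y + gradient P y = 0)
    (hν : 0 < ν) {r : ℝ≥0∞} (hr : 1 < r)
    (hr' : r < ⊤) {S : ℝ} (hS : 0 < S) {c : (EuclideanSpace ℝ (Fin 3)) → ℝ} {KF KU KD KP : ℝ} (hKF : 0 ≤ KF) (hKU : 0 ≤ KU)
    (hKD : 0 ≤ KD) (hKP : 0 ≤ KP) {m : ℕ}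
    (hF : ∀ x₀ : (EuclideanSpace ℝ (Fin 3)), eLpNorm (fun x => a • U x + a • fderiv ℝ U x x + (B (U x) - fderiv ℝ U x (B x)) + convect U U x) r
      (volume.restrict (ball x₀ (2 * S))) ≤ ENNReal.ofReal (KF * (1 + ‖x₀‖) ^ m))
    (hUr : ∀ x₀ : (EuclideanSpace ℝ (Fin 3)), eLpNorm U r (volume.restrict (ball x₀ (2 * S))) ≤ ENNReal.ofReal (KU * (1 + ‖x₀‖) ^ m))
    (hDr : ∀ x₀ : (EuclideanSpace ℝ (Fin 3)), eLpNorm (fun x => fderiv ℝ U x) r (volume.restrict (ball x₀ (2 * S))) ≤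
      ENNReal.ofReal (KD * (1 + ‖x₀‖) ^ m))
    (hPr : ∀ x₀ : (EuclideanSpace ℝ (Fin 3)), eLpNorm (fun x => P x - c x₀) r (volume.restrict (ball x₀ (2 * S))) ≤
      ENNReal.ofReal (KP * (1 + ‖x₀‖) ^ m)) :
    ∃ K : ℝ, 0 ≤ K ∧ ∀ x₀ : (EuclideanSpace ℝ (Fin 3)),
      eLpNorm (fun x => iteratedFDeriv ℝ 2 U x) r (volume.restrict (ball x₀ S)) ≤
          ENNReal.ofReal (K * (1 + ‖x₀‖) ^ m) ∧
        eLpNorm (fun x => fderiv ℝ P x) r (volume.restrict (ball x₀ S)) ≤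
          ENNReal.ofReal (K * (1 + ‖x₀‖) ^ m) := by
  obtain ⟨C, hC⟩ := stokes_estimate_of_rotated hSt hU hP2 hdiv heq hν hr hr' hS
  refine ⟨C * (KF + KU + KD + KP), by positivity, fun x₀ => ?_⟩
  have ht : 0 ≤ ‖x₀‖ := norm_nonneg _
  have h := hC x₀ (c x₀)
  have hsum : (C : ℝ≥0∞) * (eLpNorm (fun x => a • U x + a • fderiv ℝ U x x + (B (U x) - fderiv ℝ U x (B x)) + convect U U x) r
        (volume.restrict (ball x₀ (2 * S))) + eLpNorm U r (volume.restrict (ball x₀ (2 * S))) +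
        eLpNorm (fun x => fderiv ℝ U x) r (volume.restrict (ball x₀ (2 * S))) +
        eLpNorm (fun x => P x - c x₀) r (volume.restrict (ball x₀ (2 * S)))) ≤
      ENNReal.ofReal ((C * (KF + KU + KD + KP)) * (1 + ‖x₀‖) ^ m) := by
    calc (C : ℝ≥0∞) * (eLpNorm (fun x => a • U x + a • fderiv ℝ U x x + (B (U x) - fderiv ℝ U x (B x)) + convect U U x) r
          (volume.restrict (ball x₀ (2 * S))) + eLpNorm U r (volume.restrict (ball x₀ (2 * S))) +
          eLpNorm (fun x => fderiv ℝ U x) r (volume.restrict (ball x₀ (2 * S))) +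
          eLpNorm (fun x => P x - c x₀) r (volume.restrict (ball x₀ (2 * S))))
        ≤ (C : ℝ≥0∞) * (ENNReal.ofReal (KF * (1 + ‖x₀‖) ^ m) + ENNReal.ofReal (KU * (1 + ‖x₀‖) ^ m) +
            ENNReal.ofReal (KD * (1 + ‖x₀‖) ^ m) + ENNReal.ofReal (KP * (1 + ‖x₀‖) ^ m)) := by
          gcongr
          · exact hF x₀
          · exact hUr x₀
          · exact hDr x₀
          · exact hPr x₀
      _ = ENNReal.ofReal ((C * (KF + KU + KD + KP)) * (1 + ‖x₀‖) ^ m) := by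
          rw [← ENNReal.ofReal_add (by positivity) (by positivity),
            ← ENNReal.ofReal_add (by positivity) (by positivity),
            ← ENNReal.ofReal_add (by positivity) (by positivity),
            ← ENNReal.ofReal_coe_nnreal, ← ENNReal.ofReal_mul (by positivity)]
          ring_nf
  have hboth := h.trans hsum
  exact ⟨le_trans le_self_add hboth, le_trans le_add_self hboth⟩

end StokesRound

end Summit.NavierStokesRegularity.NavierStokesRegularity.Theorems.CoriolisHead

end
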